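import Mathlib

/-!
# Hypothesis (L) excludes eigenvalues to the right of `ω` (cap g6, cell `ns-blowup`, 2026-08-26)

HONEST FRAMING (human ruling D-0035): nothing here is a claim about Navier–Stokes blow-up.
WHAT THIS IS NOT: not NS evidence. This file records the EIGENVALUE form of THEOREM 3-L
(`instab/INSTAB-BRIDGE.md` §11 l.108; kernel trajectory form
`Summit.NavierStokesRegularity.FluidComputer.LyapunovSkewCutSemigroup.norm_le_of_generator_form`,
p416235): the inequality a 3-L certificate verifies (the D2 driver `d2_cert.py`; chain
`HOME/cap/D2-CHAIN-MAP.md` S1–S8, S8 = `ShellBlockLyapunovForm` p441508),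

  (L)  `Re⟪G w, A w⟫ ≤ ω · Re⟪G w, w⟫` for every `w` in the domain `D`,

with a symmetric weight `G` that is positive on `D ∖ {0}`, forces every eigenvalue `λ` of `A` with an
eigenvector in `D` to satisfy `Re λ ≤ ω`. Unlike the semigroup bound, this consequence needs NO
semigroup-generation clause (D2-CHAIN-MAP S9): it is read off at the eigenvector itself. It is the
sentence by which a 3-L certificate at a NEGATIVE `ω` is an EXCLUSION certificate («no eigenvalue of
the MODEL linearisation in this symmetry class with `Re λ > ω`»), e.g. the lower side of an
instability-onset bracket.

* `im_inner_self_eq_zero_of_symmetric`, `inner_weight_smul_right_re` — for a symmetric `G`,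
  `⟪G v, v⟫` is real, so `Re⟪G v, λ • v⟫ = Re λ · Re⟪G v, v⟫`.
* `re_eigenvalue_le_of_generator_form` — `A v = λ • v`, `0 < Re⟪G v, v⟫`, (L) at `v` ⇒ `Re λ ≤ ω`.
* `re_eigenvalue_le_of_generator_form_on` — the same with (L) quantified over a domain `D ∋ v` and
  positivity from a lower weight bound `m‖x‖² ≤ Re⟪G x, x⟫`, `m > 0`, `v ≠ 0`.
* `no_eigenvector_of_generator_form_on` — contrapositive: if `ω < Re λ` then `A` has no eigenvector
  for `λ` in `D`.

Mathlib only; no new definitions; std axioms.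
-/

noncomputable section

namespace Summit.NavierStokesRegularity.FluidComputer.LyapunovEigenvalueExclusion

open RCLike
open scoped InnerProductSpace ComplexConjugate

variable {𝕜 E : Type*} [RCLike 𝕜] [NormedAddCommGroup E] [InnerProductSpace 𝕜 E]

/-- For a symmetric weight `G` (`⟪G x, y⟫ = ⟪x, G y⟫`), the diagonal value `⟪G v, v⟫` is real. -/
theorem im_inner_self_eq_zero_of_symmetric {G : E → E}
    (hG : ∀ x y : E, ⟪G x, y⟫_𝕜 = ⟪x, G y⟫_𝕜) (v : E) : im ⟪G v, v⟫_𝕜 = 0 := by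
  have h1 : conj ⟪G v, v⟫_𝕜 = ⟪G v, v⟫_𝕜 := by
    rw [hG v v, inner_conj_symm]
    exact (hG v v)
  exact conj_eq_iff_im.mp h1

/-- For a symmetric weight `G`: `Re⟪G v, λ • v⟫ = Re λ · Re⟪G v, v⟫`. -/
theorem inner_weight_smul_right_re {G : E → E}
    (hG : ∀ x y : E, ⟪G x, y⟫_𝕜 = ⟪x, G y⟫_𝕜) (v : E) (lam : 𝕜) :
    re ⟪G v, lam • v⟫_𝕜 = re lam * re ⟪G v, v⟫_𝕜 := by
  rw [inner_smul_right, mul_re, im_inner_self_eq_zero_of_symmetric hG v, mul_zero, sub_zero]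

/-- **Eigenvalue exclusion from hypothesis (L) at the eigenvector.** If `A v = λ • v`, the weight
is symmetric with `0 < Re⟪G v, v⟫`, and (L) holds at `v`: `Re⟪G v, A v⟫ ≤ ω · Re⟪G v, v⟫`, then
`Re λ ≤ ω`. (Pair (L) with `A v = λ v`: `(Re λ − ω) · Re⟪G v, v⟫ ≤ 0`.) -/
theorem re_eigenvalue_le_of_generator_form {G : E → E}
    (hG : ∀ x y : E, ⟪G x, y⟫_𝕜 = ⟪x, G y⟫_𝕜) {A : E → E} {v : E} {lam : 𝕜} {ω : ℝ}
    (hv : A v = lam • v) (hpos : 0 < re ⟪G v, v⟫_𝕜)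
    (hL : re ⟪G v, A v⟫_𝕜 ≤ ω * re ⟪G v, v⟫_𝕜) : re lam ≤ ω := by
  rw [hv, inner_weight_smul_right_re hG v lam] at hL
  exact le_of_mul_le_mul_right hL hpos

/-- **Eigenvalue exclusion, domain form (what a 3-L certificate at `ω` says about the point
spectrum).** Let `G` be a symmetric weight with `m‖x‖² ≤ Re⟪G x, x⟫` for all `x`, `m > 0`, and let
(L) hold on a domain `D`: `Re⟪G w, A w⟫ ≤ ω · Re⟪G w, w⟫` for every `w ∈ D`. Then every eigenpair
`A v = λ • v` with `v ∈ D`, `v ≠ 0` has `Re λ ≤ ω`. No semigroup-generation clause is used. -/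
theorem re_eigenvalue_le_of_generator_form_on {G : E → E}
    (hG : ∀ x y : E, ⟪G x, y⟫_𝕜 = ⟪x, G y⟫_𝕜) {m ω : ℝ} (hm0 : 0 < m)
    (hm : ∀ x : E, m * ‖x‖ ^ 2 ≤ re ⟪G x, x⟫_𝕜)
    {D : Set E} {A : E → E} (hL : ∀ w ∈ D, re ⟪G w, A w⟫_𝕜 ≤ ω * re ⟪G w, w⟫_𝕜)
    {v : E} {lam : 𝕜} (hvD : v ∈ D) (hv0 : v ≠ 0) (hv : A v = lam • v) : re lam ≤ ω := by
  have hpos : 0 < re ⟪G v, v⟫_𝕜 := by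
    have h1 : 0 < m * ‖v‖ ^ 2 := by
      have : 0 < ‖v‖ := norm_pos_iff.mpr hv0
      positivity
    exact h1.trans_le (hm v)
  exact re_eigenvalue_le_of_generator_form hG hv hpos (hL v hvD)

/-- **Contrapositive: a 3-L certificate at `ω` leaves no eigenvector in `D` for any `λ` with
`ω < Re λ`.** In particular a certificate at some `ω < 0` excludes every eigenvalue with
`Re λ ≥ 0` of the class section (the lower side of an onset bracket). -/
theorem no_eigenvector_of_generator_form_on {G : E → E}
    (hG : ∀ x y : E, ⟪G x, y⟫_𝕜 = ⟪x, G y⟫_𝕜) {m ω : ℝ} (hm0 : 0 < m)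
    (hm : ∀ x : E, m * ‖x‖ ^ 2 ≤ re ⟪G x, x⟫_𝕜)
    {D : Set E} {A : E → E} (hL : ∀ w ∈ D, re ⟪G w, A w⟫_𝕜 ≤ ω * re ⟪G w, w⟫_𝕜)
    {lam : 𝕜} (hlam : ω < re lam) : ∀ v ∈ D, A v = lam • v → v = 0 := by
  intro v hvD hv
  by_contra hv0
  exact absurd (re_eigenvalue_le_of_generator_form_on hG hm0 hm hL hvD hv0 hv) (not_le.mpr hlam)


section Classwise

/-! ### Appended (v2, cap g6): class-wise certificates exclude eigenvalues on the whole space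

If the space splits by finitely many linear maps `P i` with `∑ i, P i v = v` that commute with `A`
(the isotypic projectors of a symmetry group commuting with the MODEL operator), then an eigenvector
of `A` has a non-zero component `P i v` in some class, and that component is an eigenvector of `A`
for the same `λ`; so class-wise hypotheses (L) at a common `ω` (one 3-L certificate per class, each
with its own weight `G i`) give `Re λ ≤ ω` for EVERY eigenpair of `A` — the census sentence «all
classes certified ⇒ the whole operator has no eigenvalue with `Re λ > ω`». -/

variable {ι : Type*} [Fintype ι]

/-- **An eigenvector has an eigen-component in some class.** If `∑ i, P i v = v` for all `v`, each
`P i` commutes with `A`, and `A v = λ • v` with `v ≠ 0`, then for some `i` the component `P i v` is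
non-zero and `A (P i v) = λ • P i v`. -/
theorem exists_component_eigenvector (P : ι → E →ₗ[𝕜] E) (hsum : ∀ v : E, ∑ i, P i v = v)
    (A : E →ₗ[𝕜] E) (hcomm : ∀ i, ∀ v : E, P i (A v) = A (P i v))
    {v : E} {lam : 𝕜} (hv0 : v ≠ 0) (hv : A v = lam • v) :
    ∃ i, P i v ≠ 0 ∧ A (P i v) = lam • P i v := by
  have heig : ∀ i, A (P i v) = lam • P i v := by
    intro i
    rw [← hcomm i v, hv, map_smul]
  by_contra h
  push Not at h
  have hall : ∀ i, P i v = 0 := fun i => by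
    by_contra hi
    exact absurd (heig i) (h i hi)
  apply hv0
  rw [← hsum v]
  exact Finset.sum_eq_zero fun i _ => hall i

/-- **Class-wise (L) ⇒ global eigenvalue exclusion.** Let `P i` (finitely many) split the space,
`∑ i, P i v = v`, and commute with `A`. Suppose that in every class there is a symmetric weight `G i`,
positive on the non-zero vectors of the class (`P i w ≠ 0 ⇒ 0 < Re⟪G i (P i w), P i w⟫`), with
hypothesis (L) at the common rate `ω` on the class: `Re⟪G i (P i w), A (P i w)⟫ ≤ ω · Re⟪G i (P i w), P i w⟫`.
Then every eigenpair `A v = λ • v`, `v ≠ 0`, of the WHOLE operator has `Re λ ≤ ω`. -/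
theorem re_eigenvalue_le_of_classwise_generator_form (P : ι → E →ₗ[𝕜] E)
    (hsum : ∀ v : E, ∑ i, P i v = v) (A : E →ₗ[𝕜] E) (hcomm : ∀ i, ∀ v : E, P i (A v) = A (P i v))
    (G : ι → E → E) (hG : ∀ i, ∀ x y : E, ⟪G i x, y⟫_𝕜 = ⟪x, G i y⟫_𝕜) {ω : ℝ}
    (hpos : ∀ i, ∀ w : E, P i w ≠ 0 → 0 < re ⟪G i (P i w), P i w⟫_𝕜)
    (hL : ∀ i, ∀ w : E, re ⟪G i (P i w), A (P i w)⟫_𝕜 ≤ ω * re ⟪G i (P i w), P i w⟫_𝕜)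
    {v : E} {lam : 𝕜} (hv0 : v ≠ 0) (hv : A v = lam • v) : re lam ≤ ω := by
  obtain ⟨i, hi0, hi⟩ := exists_component_eigenvector P hsum A hcomm hv0 hv
  exact re_eigenvalue_le_of_generator_form (A := fun x => A x) (hG i) hi (hpos i v hi0) (hL i v)

end Classwise

end Summit.NavierStokesRegularity.FluidComputer.LyapunovEigenvalueExclusion

end
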